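import Summits.QuantumFields.YangMills.Theorems.SoloBlindNoUniformRate
import Summits.QuantumFields.YangMills.Theorems.SoloBlindVarianceFloor
import HarnessLib

/-!
# IR-0 for plaquette fields from the ratio bound alone (solo-QuantumFields-blind, rung D10′)

Rung D9 (`SoloBlindNoUniformRate`) derives `CorrelationLengthDiverges r A` (no `β`-uniform
torus-uniform clustering rate) from the typed input `HasLocalGaussianRatios r A`, a conjunction of
(i) a VARIANCE FLOOR `δ ≤ c_{A,A}(0; S)` and (ii) a RATIO BOUND `ρ₀·c_{A,A}(0; S) ≤ c_{A,A}(n; S)`,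
both eventually in `S` at each large `β`.  Rung D10 (`SoloBlindVarianceFloor`) proved (i) for the
plaquette field at every coupling.  This file records the consequence: for spatial plaquette
fields `Re tr ρ'(U_p)` with `Re tr ρ'` non-constant on `G` (positive Haar variance) the ONLY
remaining input of IR-0 is the ratio bound (ii) — `HasGaussianRatioBound`, the exact content of
Theorem A + App. A of the accompanying paper (`paper/local-gaussianity.md`: local expectations are
Maxwell to `o_β(1)` uniformly in the volume, and the free ratios `κ(n)/κ(0) ≍ n^{-2d}` beat every
exponential).

* `HasGaussianRatioBound r A` — the ratio input alone.
* `hasLocalGaussianRatios_plaquette_of_ratioBound` — (ii) ⇒ D9's full input, for plaquette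
  fields with positive Haar variance (the floor is `e^{-K|β|}·Var_Haar`, from D10).
* `correlationLengthDiverges_plaquette_of_ratioBound` — (ii) ⇒ IR-0 for spatial plaquette
  fields (`i, j ≠ 0`, `i ≠ j`).

Not decay, not IR-1; `U(1)` satisfies hypothesis and conclusion.

References: S. Chatterjee, arXiv:1803.01950, Problem 5.1(b) (IR-0 as an open problem);
E. Seiler, LNP 159 (1982) Ch. 2. [this unit's typed statements]
-/

open MeasureTheory Filter Topology
open Literature.MathematicalPhysics.QuantumFieldTheory Literature.MathematicalPhysics.QuantumLattice

noncomputable section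

namespace Summit.QuantumFields.YangMills.Theorems.SoloBlind

variable {G : Type} [Group G] [TopologicalSpace G] [IsTopologicalGroup G] [CompactSpace G]
  [MeasurableSpace G] [BorelSpace G] [SecondCountableTopology G]

/-- **The ratio input of IR-0** for the species `A`: for every rate `m₀ > 0` there are a
separation `n` and a ratio `ρ₀ > e^{-m₀ n}` with `ρ₀ · c_{A,A}(0; S) ≤ c_{A,A}(n; S)` for all large
`β` and then all large `S` (local Gaussianity of the short-distance ratios, uniformly in the
volume; paper Theorem A + App. A).  The variance-floor half of `HasLocalGaussianRatios` is
omitted: for plaquette fields it is a theorem (`exists_varianceFloor_plaquette`). -/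
def HasGaussianRatioBound (r : LatticeRep G) (A : YMSpecies G) : Prop :=
  ∀ m₀ : ℝ, 0 < m₀ → ∃ n : ℕ, ∃ ρ₀ : ℝ, Real.exp (-(m₀ * n)) < ρ₀ ∧
    ∀ᶠ β : ℝ in atTop, ∀ᶠ S : ℕ in atTop,
      ρ₀ * latticeConnectedCorr r.ρ β (2 * S + 1) A.F A.F 0 ≤
        latticeConnectedCorr r.ρ β (2 * S + 1) A.F A.F n

omit [SecondCountableTopology G] in
/-- `HasLocalGaussianRatios` trivially contains the ratio bound. -/
theorem HasLocalGaussianRatios.ratioBound {r : LatticeRep G} {A : YMSpecies G}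
    (h : HasLocalGaussianRatios r A) : HasGaussianRatioBound r A := by
  intro m₀ hm₀
  obtain ⟨n, ρ₀, hρ₀, hβ⟩ := h m₀ hm₀
  refine ⟨n, ρ₀, hρ₀, ?_⟩
  filter_upwards [hβ] with β hδ
  obtain ⟨δ, -, hS⟩ := hδ
  filter_upwards [hS] with S hS' using hS'.2

/-- **Ratio bound ⇒ D9's full input, for plaquette fields.**  If `Re tr ρ'` has positive Haar
variance, the ratio bound for `P = plaquetteObservable ρ' _ i j` (`i ≠ j`) implies
`HasLocalGaussianRatios r P`: the variance floor at coupling `β` is `e^{-K(r)|β|}·Var_Haar(Re tr ρ')`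
(rung D10, one-link quasi-invariance + Haar average), valid for every `S ≥ 1`. -/
theorem hasLocalGaussianRatios_plaquette_of_ratioBound (r : LatticeRep G) {M : ℕ}
    (ρ' : G →* Matrix (Fin M) (Fin M) ℂ) (hρ' : Continuous ρ') {i j : Fin 4} (hij : i ≠ j)
    (hvar : 0 < ∫ g, ((ρ' g).trace.re - ∫ h, (ρ' h).trace.re ∂(haarProbability G)) ^ 2
      ∂(haarProbability G))
    (h : HasGaussianRatioBound r (plaquetteObservable ρ' hρ' i j)) :
    HasLocalGaussianRatios r (plaquetteObservable ρ' hρ' i j) := by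
  intro m₀ hm₀
  obtain ⟨n, ρ₀, hρ₀, hβ⟩ := h m₀ hm₀
  obtain ⟨K, -, hK⟩ := exists_varianceFloor_plaquette r.ρ r.continuous ρ' hρ' hij
  refine ⟨n, ρ₀, hρ₀, ?_⟩
  filter_upwards [hβ] with β hS
  refine ⟨Real.exp (-(K * |β|)) *
      ∫ g, ((ρ' g).trace.re - ∫ h, (ρ' h).trace.re ∂(haarProbability G)) ^ 2
        ∂(haarProbability G), mul_pos (Real.exp_pos _) hvar, ?_⟩
  filter_upwards [hS, eventually_ge_atTop 1] with S hS' hS1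
  exact ⟨hK β S hS1, hS'⟩

/-- **IR-0 for spatial plaquette fields from the ratio bound alone.**  For spatial directions
`i, j ≠ 0`, `i ≠ j`, a continuous representation `ρ'` with `Re tr ρ'` of positive Haar variance,
and any lattice representation data `r` (the action): the ratio bound for
`P = plaquetteObservable ρ' _ i j` forces `CorrelationLengthDiverges r P` — for every rate
`m₀ > 0`, eventually in `β`, the pair `(P, P)` does not cluster torus-uniformly at rate `m₀`. -/
theorem correlationLengthDiverges_plaquette_of_ratioBound (r : LatticeRep G) {M : ℕ}
    (ρ' : G →* Matrix (Fin M) (Fin M) ℂ) (hρ' : Continuous ρ') {i j : Fin 4} (hi : i ≠ 0)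
    (hj : j ≠ 0) (hij : i ≠ j)
    (hvar : 0 < ∫ g, ((ρ' g).trace.re - ∫ h, (ρ' h).trace.re ∂(haarProbability G)) ^ 2
      ∂(haarProbability G))
    (h : HasGaussianRatioBound r (plaquetteObservable ρ' hρ' i j)) :
    CorrelationLengthDiverges r (plaquetteObservable ρ' hρ' i j) := by
  have hP : IsTimeZeroSpatial (plaquetteObservable ρ' hρ' i j) := by
    unfold IsTimeZeroSpatial
    intro e he
    change e ∈ originPlaquetteSupport i j at he
    simp only [originPlaquetteSupport, Finset.mem_insert, Finset.mem_singleton] at he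
    rcases he with rfl | rfl | rfl | rfl
    · exact ⟨rfl, hi⟩
    · exact ⟨by simp [hi.symm], hj⟩
    · exact ⟨by simp [hj.symm], hi⟩
    · exact ⟨rfl, hj⟩
  exact correlationLengthDiverges_of_localRatios r _ hP
    (hasLocalGaussianRatios_plaquette_of_ratioBound r ρ' hρ' hij hvar h)

/-- The same along any sequence `β_k → ∞` (the statement's weak-coupling schemes): for every
`m₀ > 0`, eventually in `k` the spatial plaquette field does not cluster at rate `m₀` at coupling
`β_k`, torus-uniformly. -/
theorem eventually_not_clustersAtRate_plaquette_of_ratioBound (r : LatticeRep G) {M : ℕ}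
    (ρ' : G →* Matrix (Fin M) (Fin M) ℂ) (hρ' : Continuous ρ') {i j : Fin 4} (hi : i ≠ 0)
    (hj : j ≠ 0) (hij : i ≠ j)
    (hvar : 0 < ∫ g, ((ρ' g).trace.re - ∫ h, (ρ' h).trace.re ∂(haarProbability G)) ^ 2
      ∂(haarProbability G))
    (h : HasGaussianRatioBound r (plaquetteObservable ρ' hρ' i j)) {m₀ : ℝ} (hm₀ : 0 < m₀)
    {βk : ℕ → ℝ} (hβ : Tendsto βk atTop atTop) :
    ∀ᶠ k in atTop, ¬ ClustersAtRate r (βk k) (plaquetteObservable ρ' hρ' i j)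
      (plaquetteObservable ρ' hρ' i j) m₀ :=
  hβ.eventually
    (correlationLengthDiverges_plaquette_of_ratioBound r ρ' hρ' hi hj hij hvar h m₀ hm₀)

end Summit.QuantumFields.YangMills.Theorems.SoloBlind

end
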